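import Mathlib

/-!
# The slaving alphabet of the inner cone system (K38)

Solo seat `solo-NavierStokesRegularity-informed`, session 17; companion of `paper/axisymmetric-rigidity.md` §5m,
LEMMA 8.35 (alphabet), LEMMA 8.34♯ (sharp rate) and the band margins of LEMMA 8.36 (certificate C5m).
Inner clock of a smooth swirling cone: `S' = C`, `C' = -ε S`, `ε S² + C² = 1` (`S ≠ 0` on the sector); flux `W' = 3WC/S + (3S/2)(U - 1)`.
LETTERS: `a := C/S`, `b := 1/S²`, `e := ε`, `o := W/S³`, `g := G̃ = 3C/S - 2W/S³`.
* `alphabet_Da`, `alphabet_Db`, `alphabet_Do`, `alphabet_Dg`: `a' = -b`, `b' = -2ab`, `o' = (3b/2)(U-1)`, `g' = -3bU`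
  (derivative values enter as hypotheses; stated cleared of denominators where convenient);
* `alphabet_linear`: `2o + g = 3a`;  `alphabet_eps`: `ε = b - a²` (the hidden relation);  `alphabet_aob`: `a o / b = W C/S²`;
  `alphabet_r`: `r := 3WC/(4S⁴) - W²/(2S⁶) = o g/4` (first slaving step, cf. K37 `slowManifold_Dr`);
* `alphabet_homog_o`, `alphabet_homog_e`: with `γ := g/a`, `o = a (3 - γ)/2` and `e = y²(1 - C²)` (`y = 1/S`, `a = yC`): the homogeneous form;
* `alphabet_X3_weight1`: `(∂_o - 2∂_g)(2·(og/4) - (3/2) a o + o²) = g/2 - (3/2)a + o = 0` on `2o + g = 3a`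
  (the weight-1 part of the mixed Gronwall coefficient vanishes);
* `energy_cross_le`: `s|δU||δY| ≤ (s²δU² + δY²)/2`;  `energy_ds_identity`: `2(s + 𝓈 - S)δs = δY - δU[(U+𝒰)/4 + WC/S²]`
  (the two algebraic steps of LEMMA 8.34♯);
* `cell_monotone_Da`: `G₂/(2C₂) - G₁/(2C₁) > 0` for `0 < G₁ < G₂`, `0 < C₂ ≤ C₁` (Δa_j increases in ε);
* `eta_lt_inv_T`: `x cos x < sin x` on `(0, π/2)` (so `η = √ε cot(√ε T) < 1/T`);
* `band_margins_C5m`: the four strict inequalities closing the band of LEMMA 8.36.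
All statements are identities/inequalities between real numbers; no new definitions; axioms: standard.
-/

namespace Summit.NavierStokesRegularity.NavierStokesRegularity.Theorems

/-- `a = C/S`: `S² a' = C' S - C S' = -(ε S² + C²) = -1`, i.e. `a' = -1/S² = -b`. -/
theorem alphabet_Da (S C ε dS dC : ℝ) (hPy : ε * S ^ 2 + C ^ 2 = 1) (hdS : dS = C) (hdC : dC = -ε * S) :
    dC * S - C * dS = -1 := by
  subst hdS; subst hdC; linear_combination (-1 : ℝ) * hPy

/-- `b = 1/S²`: `b' = -2 S'/S³ = -2 (C/S)(1/S²) = -2ab`. -/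
theorem alphabet_Db (S C dS : ℝ) (hS : S ≠ 0) (hdS : dS = C) :
    -2 * dS / S ^ 3 = -2 * (C / S) * (1 / S ^ 2) := by
  subst hdS; field_simp

/-- `o = W/S³`: `S⁶ o' = W' S³ - 3 W S² S' = (3/2) S⁴ (U - 1)`, i.e. `o' = (3/2)(1/S²)(U - 1) = (3b/2)(U-1)` (stated multiplied by `S⁶`). -/
theorem alphabet_Do (W U S C dS dW : ℝ) (hdS : dS = C)
    (hdW : S * dW = 3 * W * C + 3 / 2 * S ^ 2 * (U - 1)) :
    dW * S ^ 3 - 3 * W * S ^ 2 * dS = 3 / 2 * S ^ 4 * (U - 1) := by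
  subst hdS
  linear_combination (S ^ 2) * hdW

/-- `g = 3a - 2o`: `g' = 3a' - 2o' = -3b - 3b(U-1) = -3bU`. -/
theorem alphabet_Dg (b U da d_o : ℝ) (hda : da = -b) (hdo : d_o = 3 / 2 * b * (U - 1)) :
    3 * da - 2 * d_o = -3 * b * U := by
  subst hda; subst hdo; ring

/-- The linear relation `2o + g = 3a`. -/
theorem alphabet_linear (W S C : ℝ) : 2 * (W / S ^ 3) + (3 * C / S - 2 * W / S ^ 3) = 3 * (C / S) := by ring

/-- The hidden relation `ε = b - a²` (from `ε S² + C² = 1`). -/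
theorem alphabet_eps (S C ε : ℝ) (hS : S ≠ 0) (hPy : ε * S ^ 2 + C ^ 2 = 1) :
    ε = 1 / S ^ 2 - (C / S) ^ 2 := by
  field_simp; linear_combination hPy

/-- The only non-polynomial coefficient: `a o / b = W C/S²`. -/
theorem alphabet_aob (W S C : ℝ) (hS : S ≠ 0) : (C / S) * (W / S ^ 3) / (1 / S ^ 2) = W * C / S ^ 2 := by
  field_simp

/-- First slaving step in letters: `r = 3WC/(4S⁴) - W²/(2S⁶) = o g/4`. -/
theorem alphabet_r (W S C : ℝ) (hS : S ≠ 0) :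
    3 * W * C / (4 * S ^ 4) - W ^ 2 / (2 * S ^ 6) = (W / S ^ 3) * (3 * C / S - 2 * W / S ^ 3) / 4 := by
  field_simp; ring

/-- Homogeneous form, flux letter: with `γ = g/a` (`a ≠ 0`) and `2o + g = 3a`, `o = a(3 - γ)/2`. -/
theorem alphabet_homog_o (a o g γ : ℝ) (ha : a ≠ 0) (hγ : γ = g / a) (hlin : 2 * o + g = 3 * a) :
    o = a * (3 - γ) / 2 := by
  have hga : γ * a = g := by rw [hγ]; field_simp
  linear_combination (1 / 2 : ℝ) * hlin + (1 / 2 : ℝ) * hga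

/-- Homogeneous form, parameter letter: `e = ε = y²(1 - C²)` with `y = 1/S`. -/
theorem alphabet_homog_e (S C ε : ℝ) (hS : S ≠ 0) (hPy : ε * S ^ 2 + C ^ 2 = 1) :
    ε = (1 / S) ^ 2 * (1 - C ^ 2) := by
  field_simp; linear_combination hPy

/-- The weight-1 part of `(∂_o - 2∂_g) Ŷ`, `Ŷ_lead = 2·(o g/4) - (3/2) a o + o²`:
`∂_o Ŷ_lead = g/2 - (3/2)a + 2o`, `∂_g Ŷ_lead = o/2`, and `(∂_o - 2∂_g)Ŷ_lead = 0` on `2o + g = 3a`. -/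
theorem alphabet_X3_weight1 (a o g : ℝ) (hlin : 2 * o + g = 3 * a) :
    (g / 2 - 3 / 2 * a + 2 * o) - 2 * (o / 2) = 0 := by
  linear_combination (1 / 2 : ℝ) * hlin

/-- LEMMA 8.34♯, step 1: the cross term is controlled by the energy, `s|δU||δY| ≤ (s²δU² + δY²)/2`. -/
theorem energy_cross_le (s dU dY : ℝ) :
    s * |dU| * |dY| ≤ (s ^ 2 * dU ^ 2 + dY ^ 2) / 2 := by
  nlinarith [sq_nonneg (s * |dU| - |dY|), sq_abs dU, sq_abs dY]

/-- LEMMA 8.34♯, step 2: the swirl defect in terms of `(δU, δY)`: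
`Y(W,U,s) - Y(W,𝒰,𝓈) = 2(s + 𝓈 - S)(s - 𝓈) + (U - 𝒰)[(U + 𝒰)/4 + WC/S²]`. -/
theorem energy_ds_identity (W S C U Uc s sc : ℝ) :
    (2 * s ^ 2 - 2 * s * S + U ^ 2 / 4 + U * W * C / S ^ 2 - 3 / 2 * W * C / S ^ 2 + W ^ 2 / S ^ 4)
      - (2 * sc ^ 2 - 2 * sc * S + Uc ^ 2 / 4 + Uc * W * C / S ^ 2 - 3 / 2 * W * C / S ^ 2 + W ^ 2 / S ^ 4)
      = 2 * (s + sc - S) * (s - sc) + (U - Uc) * ((U + Uc) / 4 + W * C / S ^ 2) := by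
  ring

/-- Certificate C5m, discretisation step: `Δa_j(ε) = C(G_j)/G_j - C(G_{j+1})/G_{j+1}` is increasing in `ε`,
because `∂_ε Δa_j = G_{j+1}/(2 C_{j+1}) - G_j/(2 C_j) > 0` when `0 < G_j < G_{j+1}` and `0 < C_{j+1} ≤ C_j`. -/
theorem cell_monotone_Da (G₁ G₂ C₁ C₂ : ℝ) (hG : 0 < G₁) (hGG : G₁ < G₂) (hC : 0 < C₂) (hCC : C₂ ≤ C₁) :
    0 < G₂ / (2 * C₂) - G₁ / (2 * C₁) := by
  have hC1 : 0 < C₁ := lt_of_lt_of_le hC hCC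
  have key : G₂ / (2 * C₂) - G₁ / (2 * C₁) = (G₂ * C₁ - G₁ * C₂) / (2 * C₁ * C₂) := by
    field_simp
  rw [key]
  apply div_pos _ (by positivity)
  nlinarith [mul_pos hG hC, mul_le_mul_of_nonneg_left hCC (le_of_lt (lt_trans hG hGG))]

/-- `η < 1/T`: for `0 < x < π/2`, `x cos x < sin x` (apply with `x = √ε T`, `η = √ε cos x / sin x`). -/
theorem eta_lt_inv_T (x : ℝ) (hx0 : 0 < x) (hx : x < Real.pi / 2) : x * Real.cos x < Real.sin x := by
  have hc : 0 < Real.cos x := Real.cos_pos_of_mem_Ioo ⟨by linarith, hx⟩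
  have ht := Real.lt_tan hx0 hx
  rw [Real.tan_eq_sin_div_cos] at ht
  exact (lt_div_iff₀ hc).1 ht

/-- The four strict margins closing the band of LEMMA 8.36 (numbers from certificate C5m):
`sup|𝒰₃| + sup|δU| < 1/5`, `sup 𝒬₃ + sup|δQ| < 1/10`, `θ_hi ≤ 0.04` (declared), `∫κ♯ < K̂ = 1.15`. -/
theorem band_margins_C5m :
    (0.0332 : ℝ) + 0.0575 < 1 / 5 ∧ (0.0218 : ℝ) + 0.0253 < 1 / 10 ∧ (0.0209 : ℝ) ≤ 0.04 ∧ (0.9705 : ℝ) < 1.15 := by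
  norm_num

end Summit.NavierStokesRegularity.NavierStokesRegularity.Theorems
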